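import Summits.Langlands.Langlands.Theorems.PhantomRMYoshidaResiduallyYoshidaLiftingReduction
import HarnessLib

/-!
# Route `PhantomRMYoshida`, crux `ResiduallyYoshidaLifting` (stmt-Langlands-13639): the KLINGEN
# (partial-weight-2) form of the two open layers, and its exact relation to the route target

Lead prover-line-stmt-Langlands-13639-a1-0 (2026-08-16), `--supports stmt-Langlands-13639` through the
registered sub-goal `stub_klingenResidues`.

Background.  Every line filed at this crux reduces it to two open layers (landed glue p83449, p97771,
p112543): L1 "every irreducible `Sh`-point of an admissible residual fibre is a `p`-adic limit of
AUTOMORPHIC ordinary Galois representations" and L2 "such limits are automorphic" (weight-(2,2)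
classicality + `GSp₄ → GL₄` transfer at the Yoshida maximal ideal).  In line A's vocabulary
(`IsOrdinaryClassicalLimit`, `…Defs.lean`) the approximants have STRICTLY INCREASING Hodge–Tate shapes in
the (2,2)-chamber, i.e. (kernel-checked by the a1-0 wave, `approximant_shape_one_ge`) Siegel weights
`(k₁, k₂)` with `k₂ ≥ (p-1)pⁿ + 2 ≥ 4`: Iwahori-ordinary, two-variable families (`I = ∅` in the notation
of Boxer–Calegari–Gee–Pilloni 2021 §4.5–4.6).  The only weight-(2,2) classicity theorem in print that is
NOT localised at a non-Eisenstein maximal ideal is the one for the ONE-variable KLINGEN family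
(`#I ≤ 1`, `l_v = 2` for `v ∈ I`): Boxer–Calegari–Gee–Pilloni 2021 Thm 4.6.1 (perfect complex `M_I` of
`Λ_I`-modules in degrees `[0, #I]`, control on the ordinary locus at every classical algebraic weight with
`l_v = 2`, `v ∈ I`) and §6.6 classicity theorem (`e(U^I) RΓ(X_{K^pK_p(I)}, ω^κ(-D))[1/p] ≃ M_I ⊗^L ℚ_p`
for `#I ≤ 1`, `l_v = 2` if `v ∈ I`, `l_v ≥ 4` if `v ∉ I` — for `F = ℚ`, `I = {p}` this is every weight
`(k, 2)`, INCLUDING `(2,2)`; Pilloni 2020 for `F = ℚ`).  Its classical points have weight `(c+1, 2)` and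
Hodge–Tate shape `(0, 0, c, c)` — NOT strictly increasing — so they are excluded by line A's hypothesis.

This file types the corresponding KLINGEN form of the two layers over the line's vocabulary and proves
(pure logic, sorry-free):

* `IsKlingenClassicalLimit p hcpt ι r` — as `IsOrdinaryClassicalLimit` but with approximants of shape
  `(0, 0, c, c)`, `c ≡ 1 (mod (p-1)pⁿ)` (p-adic weight `(c+1, 2) → (2, 2)`), Greenberg-ordinary AND
  residually distinguished of that shape (now contentful: the shape has equal entries);
* `EveryShIsKlingenLimit` (KL1) and `KlingenLimitClassicality` (KL2), same binders as
  `EveryShIsLimit` / `OrdinaryLimitClassicality`;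
* `residuallyYoshidaLifting_of_klingen : KL1 → KL2 → crux`, `phantomRMSector_of_klingen : KL1 → KL2 →
  target`;
* `isKlingenClassicalLimit_of_aut`: an AUTOMORPHIC `Sh`-point is its own Klingen approximant (`c = 1`),
  hence `everyShIsKlingenLimit_of_phantomRMSector`, `klingenLimitClassicality_of_phantomRMSector` and
  **`phantomRMSector_iff_klingen : PhantomRMSector ↔ (KL1 ∧ KL2)`** — the Klingen split is an EXACT
  decomposition of the route target (no excess), whereas line A's split has the excess `EveryShIsLimit`
  (standing disprover's T8: `(STUB 1 ∧ STUB 4) ⟺ (Absolute ∧ EveryShIsLimit)`), because regular-weight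
  approximants are NOT supplied by the target while weight-(2,2) ones are (trivially).

What is NOT claimed: neither KL1 nor KL2 is in print at a residually split Yoshida `𝔪` (KL2 still needs
the automorphic description of `H¹(M_{Kli} ⊗^L (2,2))` and multiplicity one at an Eisenstein-type `𝔪`;
KL1 with `c > 1` forced would be Klingen-family density = the same missing `R = 𝕋`); see the a1-0 wave
dossier `StubOrdinaryLimitClassicality-dossier.md` on the crux item.  The statements are recorded so
that the planner can file the glued split in the form nearest to print.
-/

noncomputable section

-- `Summit.Langlands.Langlands.…` (summit = sub-problem name, D-0017 layout) trips `dupNamespace` on every decl.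
set_option linter.dupNamespace false
set_option autoImplicit false

open IsDedekindDomain Filter
open Literature.NumberTheory.GaloisRepresentations Literature.NumberTheory.Automorphic

namespace Summit.Langlands.Langlands.Cruxes.ResiduallyYoshidaLifting.YoshidaDivisorSelmerCount

/-! ## The Klingen-family limit notion -/

/-- The partial-weight-2 Hodge–Tate shape `(0, 0, c, c)` (Siegel weight `(c+1, 2)`) is never strictly
increasing: Klingen-family approximants are excluded by `IsOrdinaryClassicalLimit`'s `StrictMono`. -/
theorem not_strictMono_shape_zero_zero (c : ℕ) : ¬ StrictMono (![0, 0, c, c] : Fin 4 → ℕ) := by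
  intro h
  have h01 : (![0, 0, c, c] : Fin 4 → ℕ) 0 < (![0, 0, c, c] : Fin 4 → ℕ) 1 :=
    h (show (0 : Fin 4) < 1 by decide)
  simp at h01

/-- `r` is a KLINGEN CLASSICAL LIMIT: outside one finite set `S` of places, for every `n`, the Frobenius
polynomials of `r` are congruent modulo `p^n` (coefficientwise, in `𝒪_{ℚ̄_p}`) to those of an
AUTOMORPHIC `r'` (clause `Aut`) which is symplectic (some similitude) and, at `p`, Greenberg-ordinary and
residually distinguished of the PARTIAL-WEIGHT-2 shape `(0, 0, c, c)` with `c ≡ 1 (mod (p-1)·p^n)`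
(p-adic weight `(c+1, 2) → (2, 2)`; `c = 1` — a weight-(2,2) automorphic point, e.g. `r` itself — is
allowed).  Intended instances: the Galois representations of the classical cuspidal points of weights
`(k, 2)`, `k → 2` p-adically, of the Klingen-ordinary (one-variable) higher-Hida family through `x_r`
(Boxer–Calegari–Gee–Pilloni 2021 §4.6, `I = {p}`; Pilloni 2020).
[cite: BoxerEtAl2021, Thm. 4.6.1 and §6.6 (the case #I = 1, l_v = 2)] -/
def IsKlingenClassicalLimit (p : ℕ) [Fact p.Prime] (hcpt : isCompact_glFiniteIntegralLevel 4 ℚ)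
    (ι : PadicAlgCl p ≃+* ℂ) (r : FramedGaloisRep ℚ (PadicAlgCl p) 4) : Prop :=
  ∃ S : Set (HeightOneSpectrum (NumberField.RingOfIntegers ℚ)), S.Finite ∧
    ∀ n : ℕ, ∃ (r' : FramedGaloisRep ℚ (PadicAlgCl p) 4) (c : ℕ),
      Aut p hcpt ι r' ∧ (c : ZMod ((p - 1) * p ^ n)) = 1 ∧
      (∃ ν : Field.absoluteGaloisGroup ℚ → PadicAlgCl p, r'.IsSymplecticWithMultiplierFun ν) ∧
      (∀ v : HeightOneSpectrum (NumberField.RingOfIntegers ℚ),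
        ((p : ℕ) : NumberField.RingOfIntegers ℚ) ∈ v.asIdeal →
          r'.IsGreenbergOrdinaryOfShapeAt v ![0, 0, c, c] ∧ r'.IsResiduallyDistinguishedAt v ![0, 0, c, c]) ∧
      ∀ v ∉ S, r.IsUnramifiedAt v ∧ r'.IsUnramifiedAt v ∧
        ∃ P P' : Polynomial (Valued.integer (PadicAlgCl p)),
          r.HasFrobCharpolyAt v (P.map (Valued.integer (PadicAlgCl p)).subtype) ∧
          r'.HasFrobCharpolyAt v (P'.map (Valued.integer (PadicAlgCl p)).subtype) ∧
          ∀ i : ℕ, ‖((P.coeff i : Valued.integer (PadicAlgCl p)) : PadicAlgCl p) -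
              ((P'.coeff i : Valued.integer (PadicAlgCl p)) : PadicAlgCl p)‖ ≤ ‖(p : PadicAlgCl p)‖ ^ n

/-! ## The two layers in Klingen form -/

/-- **KL1 — `EveryShIsKlingenLimit`**: on every admissible residual fibre (`σ̄, σ̄'` irreducible,
non-conjugate, `det σ̄ = det σ̄' = ε̄⁻¹`) every IRREDUCIBLE representation `ρ` with `Sh ρ` is a Klingen
classical limit.  Same binders as `EveryShIsLimit`, conclusion `IsKlingenClassicalLimit`.  Implied by the
route target (`everyShIsKlingenLimit_of_phantomRMSector`); its intended (stronger) reading — approximation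
by classical points of weights `(k,2)`, `k > 2` — is the Klingen-family pro-automorphy at the Yoshida
maximal ideal, OPEN IN PRINT (an open statement of this crux; no citation tag on purpose). -/
def EveryShIsKlingenLimit : Prop :=
  ∀ (p : ℕ) [Fact p.Prime], p ≠ 2 → ∀ (k : Type) [Field k] [CharP k p] [IsAlgClosed k]
    [TopologicalSpace k] [DiscreteTopology k] (red : Valued.integer (PadicAlgCl p) →+* k)
    (σ σ' : FramedGaloisRep ℚ k 2) (hcpt : isCompact_glFiniteIntegralLevel 4 ℚ) (ι : PadicAlgCl p ≃+* ℂ)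
    (ρ : FramedGaloisRep ℚ (PadicAlgCl p) 4),
    σ.toGaloisRep.IsIrreducible → σ'.toGaloisRep.IsIrreducible → DetC p k σ σ' →
    (¬ ∃ g : GL (Fin 2) k, ∀ x, g * σ x * g⁻¹ = σ' x) →
    ρ.toGaloisRep.IsIrreducible → Sh p k red σ σ' ρ → IsKlingenClassicalLimit p hcpt ι ρ

/-- **KL2 — `KlingenLimitClassicality`**: weight-(2,2) classicality of Klingen classical limits at an
admissible Yoshida residual type: an irreducible `Sh`-representation which is a Klingen classical limit
is automorphic.  Same binders as `OrdinaryLimitClassicality`.  Implied by the route target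
(`klingenLimitClassicality_of_phantomRMSector`).  Nearest print: Boxer–Calegari–Gee–Pilloni 2021
Thm 4.6.1 + §6.6 (unlocalised classicity of the Klingen higher-Hida complex at weight (2,2)); still
OPEN at a residually split Yoshida `𝔪` (automorphic description of `H¹`, multiplicity one, Galois-to-Hecke
passage).  An OPEN statement of this crux (conjecture-grade, like `OrdinaryLimitClassicality`), deliberately
carrying no citation tag: it is not a published fact and must not be relocated to `Literature/`. -/
def KlingenLimitClassicality : Prop :=
  ∀ (p : ℕ) [Fact p.Prime], p ≠ 2 → ∀ (k : Type) [Field k] [CharP k p] [IsAlgClosed k]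
    [TopologicalSpace k] [DiscreteTopology k] (red : Valued.integer (PadicAlgCl p) →+* k)
    (σ σ' : FramedGaloisRep ℚ k 2) (hcpt : isCompact_glFiniteIntegralLevel 4 ℚ) (ι : PadicAlgCl p ≃+* ℂ)
    (r : FramedGaloisRep ℚ (PadicAlgCl p) 4),
    σ.toGaloisRep.IsIrreducible → σ'.toGaloisRep.IsIrreducible → DetC p k σ σ' →
    (¬ ∃ g : GL (Fin 2) k, ∀ x, g * σ x * g⁻¹ = σ' x) →
    r.toGaloisRep.IsIrreducible → Sh p k red σ σ' r → IsKlingenClassicalLimit p hcpt ι r →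
    Aut p hcpt ι r

/-! ## Glue: the crux and the target from (KL1, KL2) -/

/-- **`EveryShIsKlingenLimit → KlingenLimitClassicality → ResiduallyYoshidaLifting`** (pure logic; the
relative data `ρ₀`, `Sh ρ₀`, `Aut ρ₀` and both oddness hypotheses are not consumed). -/
theorem residuallyYoshidaLifting_of_klingen (hL : EveryShIsKlingenLimit)
    (h₄ : KlingenLimitClassicality) :
    Summit.Langlands.Langlands.Theses.PhantomRMYoshida.ResiduallyYoshidaLifting := by
  intro p _ hp k _ _ _ _ _ red σ σ' hcpt ι ρ₀ ρ _εb _Aut _Sh _ _ hσ hσ' hdet hnc _ _ _ hρ hSh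
  exact h₄ p hp k red σ σ' hcpt ι ρ hσ hσ' hdet hnc hρ hSh
    (hL p hp k red σ σ' hcpt ι ρ hσ hσ' hdet hnc hρ hSh)

/-- **`EveryShIsKlingenLimit → KlingenLimitClassicality → PhantomRMSector`** (the split is absolute). -/
theorem phantomRMSector_of_klingen (hL : EveryShIsKlingenLimit) (h₄ : KlingenLimitClassicality) :
    Summit.Langlands.Langlands.Theses.PhantomRMYoshida.PhantomRMSector := by
  intro p _ hp k _ _ _ _ _ red σ σ' hcpt ι ρ _εb _ _ hσ hσ' hdet hnc hρ hSh
  exact h₄ p hp k red σ σ' hcpt ι ρ hσ hσ' hdet hnc hρ hSh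
    (hL p hp k red σ σ' hcpt ι ρ hσ hσ' hdet hnc hρ hSh)

/-! ## The target implies both Klingen layers: an automorphic `Sh`-point is its own approximant -/

/-- An AUTOMORPHIC representation with `Sh r` is a Klingen classical limit: at every depth `n` take
`r' = r`, `c = 1` (shape `(0,0,1,1)` = the `Sh` clause at `p`), `S` = the finite exceptional set of the
a.e. Frobenius clause of `Sh r`, and equal Frobenius polynomials (difference `0`). -/
theorem isKlingenClassicalLimit_of_aut {p : ℕ} [Fact p.Prime] {k : Type} [Field k]
    [TopologicalSpace k] {red : Valued.integer (PadicAlgCl p) →+* k} {σ σ' : FramedGaloisRep ℚ k 2}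
    {hcpt : isCompact_glFiniteIntegralLevel 4 ℚ} {ι : PadicAlgCl p ≃+* ℂ}
    {r : FramedGaloisRep ℚ (PadicAlgCl p) 4} (hSh : Sh p k red σ σ' r) (hA : Aut p hcpt ι r) :
    IsKlingenClassicalLimit p hcpt ι r := by
  obtain ⟨hsymp, hord, hae⟩ := hSh
  refine ⟨{v | ¬ (r.IsUnramifiedAt v ∧ ∃ P : Polynomial (Valued.integer (PadicAlgCl p)),
      r.HasFrobCharpolyAt v (P.map (Valued.integer (PadicAlgCl p)).subtype))}, ?_, ?_⟩
  · have : ∀ᶠ v : HeightOneSpectrum (NumberField.RingOfIntegers ℚ) in Filter.cofinite,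
        r.IsUnramifiedAt v ∧ ∃ P : Polynomial (Valued.integer (PadicAlgCl p)),
          r.HasFrobCharpolyAt v (P.map (Valued.integer (PadicAlgCl p)).subtype) := by
      filter_upwards [hae] with v hv
      obtain ⟨hur, _, _, P, _, _, hP, _⟩ := hv
      exact ⟨hur, P, hP⟩
    exact Filter.eventually_cofinite.1 this
  · intro n
    refine ⟨r, 1, hA, by simp, ⟨_, hsymp⟩, fun v hv => hord v hv, fun v hv => ?_⟩
    simp only [Set.mem_setOf_eq, not_not] at hv
    obtain ⟨hur, P, hP⟩ := hv
    exact ⟨hur, hur, P, P, hP, hP, fun i => by simp⟩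

/-- **target ⟹ KL1**: under `PhantomRMSector` every irreducible `Sh`-point is automorphic, hence its own
Klingen approximant (oddness from `DetC`). -/
theorem everyShIsKlingenLimit_of_phantomRMSector
    (h : Summit.Langlands.Langlands.Theses.PhantomRMYoshida.PhantomRMSector) :
    EveryShIsKlingenLimit := by
  intro p _ hp k _ _ _ _ _ red σ σ' hcpt ι ρ hσ hσ' hdet hnc hρ hSh
  exact isKlingenClassicalLimit_of_aut hSh
    (h p hp k red σ σ' hcpt ι ρ (isOdd_of_detC hdet).1 (isOdd_of_detC hdet).2 hσ hσ' hdet hnc hρ hSh)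

/-- **target ⟹ KL2** (the limit hypothesis is simply dropped; oddness from `DetC`): KL2 carries no risk
beyond conjunct (B). -/
theorem klingenLimitClassicality_of_phantomRMSector
    (h : Summit.Langlands.Langlands.Theses.PhantomRMYoshida.PhantomRMSector) :
    KlingenLimitClassicality := by
  intro p _ hp k _ _ _ _ _ red σ σ' hcpt ι r hσ hσ' hdet hnc hr hSh _hlim
  exact h p hp k red σ σ' hcpt ι r (isOdd_of_detC hdet).1 (isOdd_of_detC hdet).2 hσ hσ' hdet hnc hr hSh

/-- **The Klingen split is an exact decomposition of the route target**:
`PhantomRMSector ↔ (EveryShIsKlingenLimit ∧ KlingenLimitClassicality)`.  (Contrast: line A's split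
`(EveryShIsLimit, OrdinaryLimitClassicality)` is strictly heavier than the target by `EveryShIsLimit`,
standing disprover's T8.) -/
theorem phantomRMSector_iff_klingen :
    Summit.Langlands.Langlands.Theses.PhantomRMYoshida.PhantomRMSector ↔
      (EveryShIsKlingenLimit ∧ KlingenLimitClassicality) :=
  ⟨fun h => ⟨everyShIsKlingenLimit_of_phantomRMSector h, klingenLimitClassicality_of_phantomRMSector h⟩,
    fun h => phantomRMSector_of_klingen h.1 h.2⟩

/-- **Registered sub-goal `stub_klingenResidues`** (`--supports stmt-Langlands-13639`): the crux from the
Klingen layers, and the exact decomposition of the target. -/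
theorem stub_klingenResidues :
    (EveryShIsKlingenLimit → KlingenLimitClassicality →
      Summit.Langlands.Langlands.Theses.PhantomRMYoshida.ResiduallyYoshidaLifting) ∧
    (Summit.Langlands.Langlands.Theses.PhantomRMYoshida.PhantomRMSector ↔
      (EveryShIsKlingenLimit ∧ KlingenLimitClassicality)) :=
  ⟨residuallyYoshidaLifting_of_klingen, phantomRMSector_iff_klingen⟩

end Summit.Langlands.Langlands.Cruxes.ResiduallyYoshidaLifting.YoshidaDivisorSelmerCount

end
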